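import Mathlib.RingTheory.TensorProduct.Maps
import Mathlib.RingTheory.Ideal.Quotient.Operations
import Mathlib.RingTheory.Ideal.Maximal
import Mathlib.RingTheory.Ideal.Over
import HarnessLib

/-!
# Crux `FrobeniusLadder.FRationalResolution` (stmt-ResolutionOfSingularities-15317), line `redirect`,
# stub `stub_diagonalizableQuotientResolution` — the TRIVIAL-RESIDUE POINT of the base-changed chart from an embedding of residue
# fields (ring mechanism of step R1 of the Galois route)

Setting of the Galois route after base change: `B → B'` (in the route `B' = B ⊗_K K'`), the chart `C` over `B` and its base change
`C' := B' ⊗_B C` over `B'`; `𝔭 ⊆ B`, `𝔔 ⊆ C` maximal over `𝔭`, `𝔔' ⊆ B'` maximal over `𝔭`. As soon as the residue field `κ(𝔔)`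
EMBEDS into `κ(𝔔')` over `κ(𝔭)` (this is what «`K'` splits the residue data» means; field part ✓ `…ResidueSeparableCapture`), the
base-changed chart has a maximal ideal `𝔚` over `𝔔'` AND over `𝔔` whose residue field is that of `𝔔'` — the «trivial residue
extension» input of `…DescendedPrimaryPiece.exists_descended_primary_piece` / `…CentreDescent`:

* **`exists_trivial_residue_point`** — given a ring hom `ι : C ⧸ 𝔔 → B' ⧸ 𝔔'` compatible with `B`, there is a maximal `𝔚 ⊆ B' ⊗_B C`
  with `𝔚 ∩ B' = 𝔔'`, `𝔚 ∩ C = 𝔔`, and every element of `B' ⊗_B C` congruent mod `𝔚` to an element of `B'`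
  (`𝔚 = ker (B' ⊗_B C → κ(𝔔'), b' ⊗ c ↦ b̄' · ι(c̄))`).

Honest label: generic commutative algebra (no stub closed by name). No definitions, no named facts, no sorry.
[cite: StacksProject, Tag 00UW; Tag 0C0S]
-/

noncomputable section

-- single-problem summit: the doubled namespace component is forced
set_option linter.dupNamespace false

open TensorProduct

namespace Summit.ResolutionOfSingularities.ResolutionOfSingularities.Theorems.FRationalResolution.TrivialResiduePoint

universe u

/-- **The trivial-residue point of the base-changed chart.** Let `B → B'` and `B → C` be algebras, `𝔔 ⊆ C` and `𝔔' ⊆ B'` maximal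
ideals, and `ι : C ⧸ 𝔔 →+* B' ⧸ 𝔔'` a ring map compatible with `B` (`ι (b̄ in C/𝔔) = b̄ in B'/𝔔'`). Then the maximal ideal
`𝔚 := ker (B' ⊗_B C → B'/𝔔', b' ⊗ c ↦ b̄' ι(c̄))` satisfies: `𝔚 ∩ B' = 𝔔'`, `𝔚 ∩ C = 𝔔`, and every element of `B' ⊗_B C` is
congruent modulo `𝔚` to (the image of) an element of `B'`. [cite: StacksProject, Tag 00UW] -/
theorem exists_trivial_residue_point {B B' C : Type u} [CommRing B] [CommRing B'] [CommRing C] [Algebra B B'] [Algebra B C]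
    (𝔔 : Ideal C) [h𝔔 : 𝔔.IsMaximal] (𝔔' : Ideal B') [h𝔔' : 𝔔'.IsMaximal]
    (ι : C ⧸ 𝔔 →+* B' ⧸ 𝔔')
    (hι : ∀ b : B, ι (Ideal.Quotient.mk 𝔔 (algebraMap B C b)) = Ideal.Quotient.mk 𝔔' (algebraMap B B' b)) :
    ∃ (𝔚 : Ideal (B' ⊗[B] C)), 𝔚.IsMaximal ∧
      𝔚.comap (algebraMap B' (B' ⊗[B] C)) = 𝔔' ∧
      𝔚.comap ((Algebra.TensorProduct.includeRight : C →ₐ[B] B' ⊗[B] C) : C →+* B' ⊗[B] C) = 𝔔 ∧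
      ∀ x : B' ⊗[B] C, ∃ b' : B', x - algebraMap B' (B' ⊗[B] C) b' ∈ 𝔚 := by
  letI : Field (C ⧸ 𝔔) := Ideal.Quotient.field 𝔔
  letI : Field (B' ⧸ 𝔔') := Ideal.Quotient.field 𝔔'
  -- the two `B`-algebra maps to `κ' = B'/𝔔'`
  let f : B' →ₐ[B] B' ⧸ 𝔔' := Ideal.Quotient.mkₐ B 𝔔'
  let g : C →ₐ[B] B' ⧸ 𝔔' :=
    { toRingHom := ι.comp (Ideal.Quotient.mk 𝔔)
      commutes' := fun b => by
        show ι (Ideal.Quotient.mk 𝔔 (algebraMap B C b)) = algebraMap B (B' ⧸ 𝔔') b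
        rw [hι b]
        rfl }
  let Φ : B' ⊗[B] C →ₐ[B] B' ⧸ 𝔔' := Algebra.TensorProduct.lift f g (fun x y => Commute.all _ _)
  have hΦl : ∀ b' : B', Φ (algebraMap B' (B' ⊗[B] C) b') = Ideal.Quotient.mk 𝔔' b' := by
    intro b'
    rw [Algebra.TensorProduct.algebraMap_apply, Algebra.algebraMap_self, RingHom.id_apply]
    show Φ (b' ⊗ₜ[B] (1 : C)) = _
    rw [Algebra.TensorProduct.lift_tmul, map_one, mul_one]
    rfl
  have hΦr : ∀ c : C, Φ ((Algebra.TensorProduct.includeRight : C →ₐ[B] B' ⊗[B] C) c) =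
      ι (Ideal.Quotient.mk 𝔔 c) := by
    intro c
    rw [Algebra.TensorProduct.includeRight_apply, Algebra.TensorProduct.lift_tmul, map_one, one_mul]
    rfl
  -- `Φ` is onto the field `B'/𝔔'`
  have hsurj : Function.Surjective Φ := by
    intro y
    obtain ⟨b', rfl⟩ := Ideal.Quotient.mk_surjective y
    exact ⟨algebraMap B' (B' ⊗[B] C) b', hΦl b'⟩
  refine ⟨RingHom.ker (Φ : B' ⊗[B] C →+* B' ⧸ 𝔔'), ?_, ?_, ?_, ?_⟩
  · exact RingHom.ker_isMaximal_of_surjective (Φ : B' ⊗[B] C →+* B' ⧸ 𝔔') hsurj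
  · ext b'
    rw [Ideal.mem_comap, RingHom.mem_ker, AlgHom.coe_toRingHom, hΦl, Ideal.Quotient.eq_zero_iff_mem]
  · ext c
    rw [Ideal.mem_comap, RingHom.mem_ker, AlgHom.coe_toRingHom, AlgHom.coe_toRingHom, hΦr,
      map_eq_zero_iff ι ι.injective, Ideal.Quotient.eq_zero_iff_mem]
  · intro x
    obtain ⟨b', hb'⟩ := Ideal.Quotient.mk_surjective (Φ x)
    refine ⟨b', ?_⟩
    rw [RingHom.mem_ker, map_sub, AlgHom.coe_toRingHom, hΦl, ← hb', sub_self]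

end Summit.ResolutionOfSingularities.ResolutionOfSingularities.Theorems.FRationalResolution.TrivialResiduePoint

end
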